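import Mathlib.Order.Filter.Ultrafilter.Basic
import Mathlib.Topology.Algebra.Order.LiminfLimsup
import Literature.MathematicalPhysics.KineticTheory.InfiniteChainGoodSetSymmetries
import HarnessLib

/-!
# Shift averaging of first-order invariant functionals of the infinite chain
(crux `LocalOhmBV.LocalOhm`, item stmt-AtomisticToContinuum-12009, line `registered`/birth; helper for the
rigidity stub `stub_oddSectorLiouville`)

For functionals `Λ` on observables of `ChainConfig` that are (1) linear on continuous polynomially bounded
cylinder observables, (2) translation-uniformly `L²(μ)`-bounded on boxes (`μ` SHIFT INVARIANT) and
(3) annihilate `liouvilleZ P (G ∘ boxRestrictAt a n)` for `C¹` polynomially bounded `G`, this file constructs the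
SHIFT AVERAGE `Λ̄ f = LIM_M (2M+1)⁻¹ ∑_{|k| ≤ M} Λ (f ∘ τ_k)` (`τ_k = chainShift k`, `LIM` the generalised limit
along `hyperfilter ℕ`): it is again in the class (same constants), shift invariant and — when `Λ` is — odd under
momentum reversal on cylinder observables, and equals `c` on every observable all of whose translates have
`Λ`-value `c`. Tools: shift covariance of boxes and of the Liouville operator (`liouvilleZ_comp_chainShift`, with `OscillatorChain.force_chainShift`),
`IsShiftInvariant.measurePreserving_chainShift`, compactness of bounded sequences along an ultrafilter.
No definitions.
-/

set_option autoImplicit false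

noncomputable section

namespace Summit.AtomisticToContinuum.FouriersLaw.Theorems.LocalOhmBirth

open MeasureTheory Filter Topology
open scoped BigOperators
open Literature.MathematicalPhysics.KineticTheory
open Literature.MathematicalPhysics.KineticTheory.HeatConduction

/-! ## Shift covariance of cylinder observables and of the Liouville operator -/

/-- Translating a cylinder observable translates its box: `(g ∘ box_{a,n}) ∘ τ_k = g ∘ box_{a+k,n}`. -/
theorem comp_boxRestrictAt_comp_chainShift {α : Type*} (a k : ℤ) (n : ℕ) (g : (Fin (n + 1) → ℝ × ℝ) → α) :
    (g ∘ boxRestrictAt a n) ∘ chainShift k = g ∘ boxRestrictAt (a + k) n := by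
  funext σ
  simp only [Function.comp_apply]
  congr 1
  funext i
  simp only [boxRestrictAt, chainShift_apply]
  congr 1
  ring

/-- Translations conjugate site updates: `τ_k(σ[x ↦ v]) = (τ_k σ)[x-k ↦ v]`. -/
theorem chainShift_update_eq (k : ℤ) (σ : ChainConfig) (x : ℤ) (v : ℝ × ℝ) :
    chainShift k (Function.update σ x v) = Function.update (chainShift k σ) (x - k) v := by
  funext y
  by_cases hy : y = x - k
  · subst hy; simp
  · have : y + k ≠ x := fun h => hy (by omega)
    simp [Function.update_of_ne this, Function.update_of_ne hy]

/-- `∂_{q_x}(f ∘ τ_k) = (∂_{q_{x-k}} f) ∘ τ_k`. -/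
theorem partialQZ_comp_chainShift_apply (k x : ℤ) (f : ChainConfig → ℝ) (σ : ChainConfig) :
    partialQZ x (f ∘ chainShift k) σ = partialQZ (x - k) f (chainShift k σ) := by
  simp only [partialQZ, Function.comp_apply, chainShift_update_eq, chainShift_apply, sub_add_cancel]

/-- `∂_{p_x}(f ∘ τ_k) = (∂_{p_{x-k}} f) ∘ τ_k`. -/
theorem partialPZ_comp_chainShift_apply (k x : ℤ) (f : ChainConfig → ℝ) (σ : ChainConfig) :
    partialPZ x (f ∘ chainShift k) σ = partialPZ (x - k) f (chainShift k σ) := by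
  simp only [partialPZ, Function.comp_apply, chainShift_update_eq, chainShift_apply, sub_add_cancel]

/-- **Shift covariance of the Liouville operator**, all translations: `𝒜(f ∘ τ_k) = (𝒜f) ∘ τ_k`
(reindexing `x ↦ x - k` of the lattice sum; no hypothesis on `f`). -/
theorem liouvilleZ_comp_chainShift (P : OscillatorChain) (k : ℤ) (f : ChainConfig → ℝ) (σ : ChainConfig) :
    liouvilleZ P (f ∘ chainShift k) σ = liouvilleZ P f (chainShift k σ) := by
  unfold liouvilleZ
  simp only [partialQZ_comp_chainShift_apply, partialPZ_comp_chainShift_apply]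
  rw [← (Equiv.subRight k).tsum_eq (fun y =>
    (chainShift k σ y).2 * partialQZ y f (chainShift k σ) + P.force (chainShift k σ) y * partialPZ y f (chainShift k σ))]
  refine tsum_congr fun x => ?_
  simp only [Equiv.subRight_apply, chainShift_apply, sub_add_cancel, OscillatorChain.force_chainShift]

/-- The shift `τ` followed by `τ_k` is `τ_{k+1}` on observables: `(f ∘ shift) ∘ τ_k = f ∘ τ_{k+1}`. -/
theorem comp_shift_comp_chainShift {α : Type*} (f : ChainConfig → α) (k : ℤ) :
    (f ∘ shift) ∘ chainShift k = f ∘ chainShift (k + 1) := by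
  funext σ; simp only [Function.comp_apply]; congr 1; funext x
  simp only [shift, chainShift_apply]; congr 1; ring

/-- Momentum reversal commutes with translations (on observables). -/
theorem comp_momentumReversalZ_comp_chainShift {α : Type*} (f : ChainConfig → α) (k : ℤ) :
    (f ∘ momentumReversalZ) ∘ chainShift k = (f ∘ chainShift k) ∘ momentumReversalZ := by
  funext σ
  simp only [Function.comp_apply]
  congr 1

/-- Integrals of translated observables against a shift-invariant state (no measurability needed:
change of variables along the measurable equivalence `τ_k`, inverse `τ_{-k}`). -/
theorem integral_comp_chainShift_of_isShiftInvariant {μ : Measure ChainConfig} (hS : IsShiftInvariant μ) (k : ℤ)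
    (F : ChainConfig → ℝ) : ∫ σ, F (chainShift k σ) ∂μ = ∫ σ, F σ ∂μ := by
  let e : ChainConfig ≃ᵐ ChainConfig :=
    { toFun := chainShift k
      invFun := chainShift (-k)
      left_inv := fun σ => by
        have := congrFun (chainShift.neg_comp k) σ
        simpa using this
      right_inv := fun σ => by
        have := congrFun (chainShift.comp_neg k) σ
        simpa using this
      measurable_toFun := chainShift.measurable k
      measurable_invFun := chainShift.measurable (-k) }
  have h := integral_map_equiv e F (μ := μ)
  have he : (⇑e : ChainConfig → ChainConfig) = chainShift k := rfl
  rw [he, (hS.measurePreserving_chainShift k).map_eq] at h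
  exact h.symm

/-- Translation invariance of `L²` norms of cylinder observables under a shift-invariant state. -/
theorem integral_sq_comp_boxRestrictAt_add {μ : Measure ChainConfig} (hS : IsShiftInvariant μ)
    (a k : ℤ) (n : ℕ) (g : (Fin (n + 1) → ℝ × ℝ) → ℝ) :
    ∫ σ, (g (boxRestrictAt (a + k) n σ)) ^ 2 ∂μ = ∫ σ, (g (boxRestrictAt a n σ)) ^ 2 ∂μ := by
  have h := integral_comp_chainShift_of_isShiftInvariant hS k (fun σ => (g (boxRestrictAt a n σ)) ^ 2)
  have hfun : ∀ σ, g (boxRestrictAt a n (chainShift k σ)) = g (boxRestrictAt (a + k) n σ) := fun σ => by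
    have := congrFun (comp_boxRestrictAt_comp_chainShift a k n g) σ
    simpa using this
  simp only [hfun] at h
  exact h

/-! ## Generalised limits of bounded real sequences along `hyperfilter ℕ` -/

/-- A bounded real sequence converges along the ultrafilter `hyperfilter ℕ` to its `limUnder`. -/
theorem tendsto_limUnder_hyperfilter_of_abs_le {u : ℕ → ℝ} {B : ℝ} (hu : ∀ M, |u M| ≤ B) :
    Tendsto u (hyperfilter ℕ : Filter ℕ) (𝓝 (limUnder (hyperfilter ℕ : Filter ℕ) u)) := by
  have hK : IsCompact (Set.Icc (-B) B) := isCompact_Icc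
  have hle : (↑((hyperfilter ℕ).map u) : Filter ℝ) ≤ 𝓟 (Set.Icc (-B) B) := by
    rw [Ultrafilter.coe_map, le_principal_iff]
    exact mem_map.2 (Filter.Eventually.of_forall fun M => abs_le.1 (hu M))
  obtain ⟨x, -, hx⟩ := hK.ultrafilter_le_nhds ((hyperfilter ℕ).map u) hle
  have ht : Tendsto u (hyperfilter ℕ : Filter ℕ) (𝓝 x) := by
    rw [Tendsto, ← Ultrafilter.coe_map]; exact hx
  exact tendsto_nhds_limUnder ⟨x, ht⟩

/-- Ordinary limits are generalised limits. -/
theorem tendsto_hyperfilter_of_tendsto_atTop {u : ℕ → ℝ} {c : ℝ} (h : Tendsto u atTop (𝓝 c)) :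
    Tendsto u (hyperfilter ℕ : Filter ℕ) (𝓝 c) :=
  h.mono_left (hyperfilter_le_cofinite.trans_eq Nat.cofinite_eq_atTop)

/-- The generalised limit of a bounded sequence is bounded by the same constant. -/
theorem abs_limUnder_hyperfilter_le {u : ℕ → ℝ} {B : ℝ} (hu : ∀ M, |u M| ≤ B) :
    |limUnder (hyperfilter ℕ : Filter ℕ) u| ≤ B := by
  have ht := tendsto_limUnder_hyperfilter_of_abs_le hu
  rw [abs_le]
  exact ⟨ge_of_tendsto' ht fun M => (abs_le.1 (hu M)).1, le_of_tendsto' ht fun M => (abs_le.1 (hu M)).2⟩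

/-! ## Cesàro sums over symmetric windows -/

/-- Shifting the summation window by one: `∑_{j<2M+1} u(j-M+1) = ∑_{j<2M+1} u(j-M) + u(M+1) - u(-M)`. -/
theorem sum_range_shift_succ (u : ℤ → ℝ) (M : ℕ) :
    ∑ j ∈ Finset.range (2 * M + 1), u ((j : ℤ) - M + 1) =
      ∑ j ∈ Finset.range (2 * M + 1), u ((j : ℤ) - M) + u ((M : ℤ) + 1) - u (-(M : ℤ)) := by
  have h1 : ∑ j ∈ Finset.range (2 * M + 1 + 1), u ((j : ℤ) - M) =
      ∑ j ∈ Finset.range (2 * M + 1), u ((j : ℤ) - M) + u ((M : ℤ) + 1) := by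
    rw [Finset.sum_range_succ]
    congr 2
    push_cast; ring
  have h2 : ∑ j ∈ Finset.range (2 * M + 1 + 1), u ((j : ℤ) - M) =
      ∑ j ∈ Finset.range (2 * M + 1), u ((j : ℤ) - M + 1) + u (-(M : ℤ)) := by
    rw [Finset.sum_range_succ']
    congr 1
    · refine Finset.sum_congr rfl fun j _ => ?_
      congr 1; push_cast; ring
    · congr 1; push_cast; ring
  linarith

/-- Cesàro means of a bounded family are bounded by the same constant. -/
theorem abs_cesaro_le {u : ℤ → ℝ} {B : ℝ} (hu : ∀ k, |u k| ≤ B) (M : ℕ) :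
    |(∑ j ∈ Finset.range (2 * M + 1), u ((j : ℤ) - M)) / (2 * M + 1)| ≤ B := by
  have hK : (0 : ℝ) < 2 * M + 1 := by positivity
  rw [abs_div, abs_of_pos hK, div_le_iff₀ hK]
  calc |∑ j ∈ Finset.range (2 * M + 1), u ((j : ℤ) - M)|
        ≤ ∑ j ∈ Finset.range (2 * M + 1), |u ((j : ℤ) - M)| := Finset.abs_sum_le_sum_abs _ _
    _ ≤ ∑ _j ∈ Finset.range (2 * M + 1), B := Finset.sum_le_sum fun j _ => hu _
    _ = B * (2 * M + 1) := by
        rw [Finset.sum_const, Finset.card_range, nsmul_eq_mul]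
        push_cast; ring

/-! ## The shift average of a functional -/

/-- **Shift averaging.** Let `μ` be a shift-invariant state of the infinite chain `P` and `Λ` a functional
on its observables which is (1) linear on continuous polynomially bounded cylinder observables,
(2) translation-uniformly `L²(μ)`-bounded on boxes and (3) annihilates the Liouville derivative of every
`C¹` polynomially bounded cylinder observable. Then there is a functional `Λ̄` (the generalised Cesàro
limit `LIM_M (2M+1)⁻¹ ∑_{|k| ≤ M} Λ(f ∘ τ_k)` along `hyperfilter ℕ`) which is SHIFT INVARIANT on continuous
polynomially bounded cylinder observables, satisfies (1)–(3) with the same constants, is odd under momentum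
reversal on such observables whenever `Λ` is, and takes the value `c` on every observable all of whose
translates have `Λ`-value `c`. -/
theorem exists_shiftAverage : ∀ (P : OscillatorChain) {μ : Measure ChainConfig}, IsShiftInvariant μ →
    ∀ (Λ : (ChainConfig → ℝ) → ℝ),
    (∀ (a : ℤ) (n : ℕ) (c₁ c₂ : ℝ) (g₁ g₂ : (Fin (n + 1) → ℝ × ℝ) → ℝ), Continuous g₁ →
      Continuous g₂ →
      (∃ (C₀ : ℝ) (m : ℕ), ∀ y, |g₁ y| ≤ C₀ * (1 + ‖y‖) ^ m ∧ |g₂ y| ≤ C₀ * (1 + ‖y‖) ^ m) →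
      Λ ((fun y => c₁ * g₁ y + c₂ * g₂ y) ∘ boxRestrictAt a n) =
        c₁ * Λ (g₁ ∘ boxRestrictAt a n) + c₂ * Λ (g₂ ∘ boxRestrictAt a n)) →
    (∀ n : ℕ, ∃ A : ℝ, ∀ (a : ℤ) (g : (Fin (n + 1) → ℝ × ℝ) → ℝ), Continuous g →
      (∃ (C₀ : ℝ) (m : ℕ), ∀ y, |g y| ≤ C₀ * (1 + ‖y‖) ^ m) →
      |Λ (g ∘ boxRestrictAt a n)| ≤ A * Real.sqrt (∫ σ, (g (boxRestrictAt a n σ)) ^ 2 ∂μ)) →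
    (∀ (a : ℤ) (n : ℕ) (G : (Fin (n + 1) → ℝ × ℝ) → ℝ), ContDiff ℝ 1 G →
      (∃ (C₀ : ℝ) (m : ℕ), ∀ y, |G y| ≤ C₀ * (1 + ‖y‖) ^ m ∧ ‖fderiv ℝ G y‖ ≤ C₀ * (1 + ‖y‖) ^ m) →
      Λ (liouvilleZ P (G ∘ boxRestrictAt a n)) = 0) →
    ∃ Λ' : (ChainConfig → ℝ) → ℝ,
      (∀ (a : ℤ) (n : ℕ) (g : (Fin (n + 1) → ℝ × ℝ) → ℝ), Continuous g →
        (∃ (C₀ : ℝ) (m : ℕ), ∀ y, |g y| ≤ C₀ * (1 + ‖y‖) ^ m) →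
        Λ' ((g ∘ boxRestrictAt a n) ∘ shift) = Λ' (g ∘ boxRestrictAt a n)) ∧
      ((∀ (a : ℤ) (n : ℕ) (g : (Fin (n + 1) → ℝ × ℝ) → ℝ), Continuous g →
          (∃ (C₀ : ℝ) (m : ℕ), ∀ y, |g y| ≤ C₀ * (1 + ‖y‖) ^ m) →
          Λ ((g ∘ boxRestrictAt a n) ∘ momentumReversalZ) = -Λ (g ∘ boxRestrictAt a n)) →
        ∀ (a : ℤ) (n : ℕ) (g : (Fin (n + 1) → ℝ × ℝ) → ℝ), Continuous g →
          (∃ (C₀ : ℝ) (m : ℕ), ∀ y, |g y| ≤ C₀ * (1 + ‖y‖) ^ m) →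
          Λ' ((g ∘ boxRestrictAt a n) ∘ momentumReversalZ) = -Λ' (g ∘ boxRestrictAt a n)) ∧
      (∀ (a : ℤ) (n : ℕ) (c₁ c₂ : ℝ) (g₁ g₂ : (Fin (n + 1) → ℝ × ℝ) → ℝ), Continuous g₁ →
        Continuous g₂ →
        (∃ (C₀ : ℝ) (m : ℕ), ∀ y, |g₁ y| ≤ C₀ * (1 + ‖y‖) ^ m ∧ |g₂ y| ≤ C₀ * (1 + ‖y‖) ^ m) →
        Λ' ((fun y => c₁ * g₁ y + c₂ * g₂ y) ∘ boxRestrictAt a n) =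
          c₁ * Λ' (g₁ ∘ boxRestrictAt a n) + c₂ * Λ' (g₂ ∘ boxRestrictAt a n)) ∧
      (∀ n : ℕ, ∃ A : ℝ, ∀ (a : ℤ) (g : (Fin (n + 1) → ℝ × ℝ) → ℝ), Continuous g →
        (∃ (C₀ : ℝ) (m : ℕ), ∀ y, |g y| ≤ C₀ * (1 + ‖y‖) ^ m) →
        |Λ' (g ∘ boxRestrictAt a n)| ≤ A * Real.sqrt (∫ σ, (g (boxRestrictAt a n σ)) ^ 2 ∂μ)) ∧
      (∀ (a : ℤ) (n : ℕ) (G : (Fin (n + 1) → ℝ × ℝ) → ℝ), ContDiff ℝ 1 G →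
        (∃ (C₀ : ℝ) (m : ℕ), ∀ y, |G y| ≤ C₀ * (1 + ‖y‖) ^ m ∧ ‖fderiv ℝ G y‖ ≤ C₀ * (1 + ‖y‖) ^ m) →
        Λ' (liouvilleZ P (G ∘ boxRestrictAt a n)) = 0) ∧
      (∀ (f : ChainConfig → ℝ) (c : ℝ), (∀ k : ℤ, Λ (f ∘ chainShift k) = c) → Λ' f = c) := by
  intro P μ hS Λ hlin hbd hinv
  -- the Cesàro means and their generalised limit
  set Av : (ChainConfig → ℝ) → ℕ → ℝ := fun f M =>
    (∑ j ∈ Finset.range (2 * M + 1), Λ (f ∘ chainShift ((j : ℤ) - M))) / (2 * M + 1) with hAv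
  -- translates of cylinder observables are cylinder observables with the same window function
  have htrans : ∀ (a : ℤ) (n : ℕ) (g : (Fin (n + 1) → ℝ × ℝ) → ℝ) (k : ℤ),
      (g ∘ boxRestrictAt a n) ∘ chainShift k = g ∘ boxRestrictAt (a + k) n :=
    fun a n g k => comp_boxRestrictAt_comp_chainShift a k n g
  -- uniform bound on `Λ` of the translates (translation-uniform bound + shift invariance of `μ`)
  have hB : ∀ n : ℕ, ∃ A : ℝ, ∀ (a : ℤ) (g : (Fin (n + 1) → ℝ × ℝ) → ℝ), Continuous g →
      (∃ (C₀ : ℝ) (m : ℕ), ∀ y, |g y| ≤ C₀ * (1 + ‖y‖) ^ m) → ∀ k : ℤ,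
      |Λ ((g ∘ boxRestrictAt a n) ∘ chainShift k)| ≤
        A * Real.sqrt (∫ σ, (g (boxRestrictAt a n σ)) ^ 2 ∂μ) := by
    intro n
    obtain ⟨A, hA⟩ := hbd n
    refine ⟨A, fun a g hg hb k => ?_⟩
    rw [htrans, ← integral_sq_comp_boxRestrictAt_add hS a k n g]
    exact hA (a + k) g hg hb
  -- hence the Cesàro means of a cylinder observable are bounded, uniformly in `M`
  have hAvbd : ∀ n : ℕ, ∃ A : ℝ, ∀ (a : ℤ) (g : (Fin (n + 1) → ℝ × ℝ) → ℝ), Continuous g →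
      (∃ (C₀ : ℝ) (m : ℕ), ∀ y, |g y| ≤ C₀ * (1 + ‖y‖) ^ m) → ∀ M : ℕ,
      |Av (g ∘ boxRestrictAt a n) M| ≤ A * Real.sqrt (∫ σ, (g (boxRestrictAt a n σ)) ^ 2 ∂μ) := by
    intro n
    obtain ⟨A, hA⟩ := hB n
    refine ⟨A, fun a g hg hb M => ?_⟩
    exact abs_cesaro_le (u := fun k => Λ ((g ∘ boxRestrictAt a n) ∘ chainShift k))
      (fun k => hA a g hg hb k) M
  -- and converge along the ultrafilter to the generalised limit
  have hconv : ∀ (a : ℤ) (n : ℕ) (g : (Fin (n + 1) → ℝ × ℝ) → ℝ), Continuous g →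
      (∃ (C₀ : ℝ) (m : ℕ), ∀ y, |g y| ≤ C₀ * (1 + ‖y‖) ^ m) →
      Tendsto (Av (g ∘ boxRestrictAt a n)) (hyperfilter ℕ : Filter ℕ)
        (𝓝 (limUnder (hyperfilter ℕ : Filter ℕ) (Av (g ∘ boxRestrictAt a n)))) := by
    intro a n g hg hb
    obtain ⟨A, hA⟩ := hAvbd n
    exact tendsto_limUnder_hyperfilter_of_abs_le (hA a g hg hb)
  refine ⟨fun f => limUnder (hyperfilter ℕ : Filter ℕ) (Av f), ?_, ?_, ?_, ?_, ?_, ?_⟩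
  · -- shift invariance on cylinder observables
    intro a n g hg hb
    obtain ⟨A, hA⟩ := hB n
    show limUnder (hyperfilter ℕ : Filter ℕ) (Av ((g ∘ boxRestrictAt a n) ∘ shift)) =
      limUnder (hyperfilter ℕ : Filter ℕ) (Av (g ∘ boxRestrictAt a n))
    -- `f ∘ shift` is the cylinder observable with the box moved by one
    have hfs : (g ∘ boxRestrictAt a n) ∘ shift = g ∘ boxRestrictAt (a + 1) n := by
      have h := htrans a n g 1
      rwa [chainShift_one] at h
    -- the Cesàro means of `f ∘ shift` differ from those of `f` by a boundary term
    have hdiff : ∀ M : ℕ, Av ((g ∘ boxRestrictAt a n) ∘ shift) M = Av (g ∘ boxRestrictAt a n) M +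
        (Λ ((g ∘ boxRestrictAt a n) ∘ chainShift ((M : ℤ) + 1)) -
          Λ ((g ∘ boxRestrictAt a n) ∘ chainShift (-(M : ℤ)))) / (2 * M + 1) := by
      intro M
      show (∑ j ∈ Finset.range (2 * M + 1),
          Λ (((g ∘ boxRestrictAt a n) ∘ shift) ∘ chainShift ((j : ℤ) - M))) / (2 * M + 1) =
        (∑ j ∈ Finset.range (2 * M + 1),
          Λ ((g ∘ boxRestrictAt a n) ∘ chainShift ((j : ℤ) - M))) / (2 * M + 1) + _
      simp only [comp_shift_comp_chainShift]
      have h2 := sum_range_shift_succ (fun k => Λ ((g ∘ boxRestrictAt a n) ∘ chainShift k)) M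
      rw [h2]
      ring
    -- the boundary term tends to zero
    have hcorr : Tendsto (fun M : ℕ => (Λ ((g ∘ boxRestrictAt a n) ∘ chainShift ((M : ℤ) + 1)) -
        Λ ((g ∘ boxRestrictAt a n) ∘ chainShift (-(M : ℤ)))) / (2 * M + 1)) atTop (𝓝 0) := by
      set B := A * Real.sqrt (∫ σ, (g (boxRestrictAt a n σ)) ^ 2 ∂μ) with hBdef
      have hbound : ∀ M : ℕ, |(Λ ((g ∘ boxRestrictAt a n) ∘ chainShift ((M : ℤ) + 1)) -
          Λ ((g ∘ boxRestrictAt a n) ∘ chainShift (-(M : ℤ)))) / (2 * M + 1)| ≤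
          2 * B * (2 * (M : ℝ) + 1)⁻¹ := by
        intro M
        have hK : (0 : ℝ) < 2 * M + 1 := by positivity
        rw [abs_div, abs_of_pos hK, div_eq_mul_inv]
        refine mul_le_mul_of_nonneg_right ?_ (inv_nonneg.2 hK.le)
        have h1 := hA a g hg hb ((M : ℤ) + 1)
        have h2 := hA a g hg hb (-(M : ℤ))
        have := abs_sub _ _ |>.trans (add_le_add h1 h2)
        linarith
      have hlim : Tendsto (fun M : ℕ => 2 * B * (2 * (M : ℝ) + 1)⁻¹) atTop (𝓝 0) := by
        have h1 : Tendsto (fun M : ℕ => 2 * (M : ℝ) + 1) atTop atTop :=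
          tendsto_atTop_add_const_right _ _ (Tendsto.const_mul_atTop two_pos tendsto_natCast_atTop_atTop)
        have h2 := tendsto_inv_atTop_zero.comp h1
        simpa using h2.const_mul (2 * B)
      exact squeeze_zero_norm (fun M => by rw [Real.norm_eq_abs]; exact hbound M) hlim
    have h1 := hconv a n g hg hb
    have h2 : Tendsto (Av ((g ∘ boxRestrictAt a n) ∘ shift)) (hyperfilter ℕ : Filter ℕ)
        (𝓝 (limUnder (hyperfilter ℕ : Filter ℕ) (Av (g ∘ boxRestrictAt a n)) + 0)) := by
      rw [show Av ((g ∘ boxRestrictAt a n) ∘ shift) = fun M => Av (g ∘ boxRestrictAt a n) M +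
        (Λ ((g ∘ boxRestrictAt a n) ∘ chainShift ((M : ℤ) + 1)) -
          Λ ((g ∘ boxRestrictAt a n) ∘ chainShift (-(M : ℤ)))) / (2 * M + 1) from funext hdiff]
      exact h1.add (tendsto_hyperfilter_of_tendsto_atTop hcorr)
    rw [add_zero] at h2
    exact h2.limUnder_eq
  · -- oddness on cylinder observables is inherited
    intro hΛodd a n g hg hb
    show limUnder (hyperfilter ℕ : Filter ℕ) (Av ((g ∘ boxRestrictAt a n) ∘ momentumReversalZ)) =
      -limUnder (hyperfilter ℕ : Filter ℕ) (Av (g ∘ boxRestrictAt a n))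
    have hk : ∀ k : ℤ, Λ (((g ∘ boxRestrictAt a n) ∘ momentumReversalZ) ∘ chainShift k) =
        -Λ ((g ∘ boxRestrictAt a n) ∘ chainShift k) := fun k => by
      rw [comp_momentumReversalZ_comp_chainShift, htrans]
      exact hΛodd (a + k) n g hg hb
    have hneg : ∀ M : ℕ, Av ((g ∘ boxRestrictAt a n) ∘ momentumReversalZ) M = -Av (g ∘ boxRestrictAt a n) M := by
      intro M
      show (∑ j ∈ Finset.range (2 * M + 1),
          Λ (((g ∘ boxRestrictAt a n) ∘ momentumReversalZ) ∘ chainShift ((j : ℤ) - M))) / (2 * M + 1) =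
        -((∑ j ∈ Finset.range (2 * M + 1),
          Λ ((g ∘ boxRestrictAt a n) ∘ chainShift ((j : ℤ) - M))) / (2 * M + 1))
      simp only [hk, Finset.sum_neg_distrib, neg_div]
    have h1 := hconv a n g hg hb
    have h2 : Tendsto (Av ((g ∘ boxRestrictAt a n) ∘ momentumReversalZ)) (hyperfilter ℕ : Filter ℕ)
        (𝓝 (-limUnder (hyperfilter ℕ : Filter ℕ) (Av (g ∘ boxRestrictAt a n)))) := by
      rw [show Av ((g ∘ boxRestrictAt a n) ∘ momentumReversalZ) = fun M => -Av (g ∘ boxRestrictAt a n) M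
        from funext hneg]
      exact h1.neg
    exact h2.limUnder_eq
  · -- linearity
    intro a n c₁ c₂ g₁ g₂ hg₁ hg₂ hb
    obtain ⟨C₀, m, hC⟩ := hb
    show limUnder (hyperfilter ℕ : Filter ℕ) (Av ((fun y => c₁ * g₁ y + c₂ * g₂ y) ∘ boxRestrictAt a n)) =
      c₁ * limUnder (hyperfilter ℕ : Filter ℕ) (Av (g₁ ∘ boxRestrictAt a n)) +
        c₂ * limUnder (hyperfilter ℕ : Filter ℕ) (Av (g₂ ∘ boxRestrictAt a n))
    have hM : ∀ M : ℕ, Av ((fun y => c₁ * g₁ y + c₂ * g₂ y) ∘ boxRestrictAt a n) M =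
        c₁ * Av (g₁ ∘ boxRestrictAt a n) M + c₂ * Av (g₂ ∘ boxRestrictAt a n) M := by
      intro M
      show (∑ j ∈ Finset.range (2 * M + 1),
          Λ (((fun y => c₁ * g₁ y + c₂ * g₂ y) ∘ boxRestrictAt a n) ∘ chainShift ((j : ℤ) - M))) / (2 * M + 1) =
        c₁ * ((∑ j ∈ Finset.range (2 * M + 1),
          Λ ((g₁ ∘ boxRestrictAt a n) ∘ chainShift ((j : ℤ) - M))) / (2 * M + 1)) +
        c₂ * ((∑ j ∈ Finset.range (2 * M + 1),
          Λ ((g₂ ∘ boxRestrictAt a n) ∘ chainShift ((j : ℤ) - M))) / (2 * M + 1))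
      simp only [htrans, hlin _ n c₁ c₂ g₁ g₂ hg₁ hg₂ ⟨C₀, m, hC⟩, Finset.sum_add_distrib, ← Finset.mul_sum]
      ring
    have h1 := hconv a n g₁ hg₁ ⟨C₀, m, fun y => (hC y).1⟩
    have h2 := hconv a n g₂ hg₂ ⟨C₀, m, fun y => (hC y).2⟩
    have h3 : Tendsto (Av ((fun y => c₁ * g₁ y + c₂ * g₂ y) ∘ boxRestrictAt a n)) (hyperfilter ℕ : Filter ℕ)
        (𝓝 (c₁ * limUnder (hyperfilter ℕ : Filter ℕ) (Av (g₁ ∘ boxRestrictAt a n)) +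
          c₂ * limUnder (hyperfilter ℕ : Filter ℕ) (Av (g₂ ∘ boxRestrictAt a n)))) := by
      rw [show Av ((fun y => c₁ * g₁ y + c₂ * g₂ y) ∘ boxRestrictAt a n) =
        fun M => c₁ * Av (g₁ ∘ boxRestrictAt a n) M + c₂ * Av (g₂ ∘ boxRestrictAt a n) M from funext hM]
      exact (h1.const_mul c₁).add (h2.const_mul c₂)
    exact h3.limUnder_eq
  · -- translation-uniform bound, same constant
    intro n
    obtain ⟨A, hA⟩ := hAvbd n
    exact ⟨A, fun a g hg hb => abs_limUnder_hyperfilter_le (hA a g hg hb)⟩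
  · -- invariance
    intro a n G hG hb
    show limUnder (hyperfilter ℕ : Filter ℕ) (Av (liouvilleZ P (G ∘ boxRestrictAt a n))) = 0
    have h0 : ∀ k : ℤ, Λ (liouvilleZ P (G ∘ boxRestrictAt a n) ∘ chainShift k) = 0 := fun k => by
      have h : liouvilleZ P (G ∘ boxRestrictAt a n) ∘ chainShift k =
          liouvilleZ P (G ∘ boxRestrictAt (a + k) n) := by
        funext σ
        rw [Function.comp_apply, ← liouvilleZ_comp_chainShift, htrans]
      rw [h]
      exact hinv (a + k) n G hG hb
    have hM : ∀ M : ℕ, Av (liouvilleZ P (G ∘ boxRestrictAt a n)) M = 0 := fun M => by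
      show (∑ j ∈ Finset.range (2 * M + 1),
          Λ (liouvilleZ P (G ∘ boxRestrictAt a n) ∘ chainShift ((j : ℤ) - M))) / (2 * M + 1) = 0
      simp only [h0, Finset.sum_const_zero, zero_div]
    rw [show Av (liouvilleZ P (G ∘ boxRestrictAt a n)) = fun _ => (0 : ℝ) from funext hM]
    exact tendsto_const_nhds.limUnder_eq
  · -- observables all of whose translates have the same `Λ`-value
    intro f c hc
    show limUnder (hyperfilter ℕ : Filter ℕ) (Av f) = c
    have hM : ∀ M : ℕ, Av f M = c := fun M => by
      show (∑ j ∈ Finset.range (2 * M + 1), Λ (f ∘ chainShift ((j : ℤ) - M))) / (2 * M + 1) = c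
      have hK : (2 * (M : ℝ) + 1) ≠ 0 := by positivity
      simp only [hc, Finset.sum_const, Finset.card_range, nsmul_eq_mul]
      push_cast
      field_simp
    rw [show Av f = fun _ => c from funext hM]
    exact tendsto_const_nhds.limUnder_eq

end Summit.AtomisticToContinuum.FouriersLaw.Theorems.LocalOhmBirth

end
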